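import Summits.RiemannHypothesis.RiemannHypothesis.Theorems.WeilGroundStateGroundStatesConvergeToXiPhiTail
import Summits.RiemannHypothesis.RiemannHypothesis.Theorems.WeilGroundStateGroundStatesConvergeToXiEnergyUpperTail
import Summits.RiemannHypothesis.RiemannHypothesis.Theorems.WeilGroundStateGroundStatesConvergeToXiStubMellinXi
import Summits.RiemannHypothesis.RiemannHypothesis.Theorems.WeilGroundStateGroundStatesConvergeToXiStubPsiDecay
import Literature.NumberTheory.LFunctions.WeilExplicit
import Literature.NumberTheory.LFunctions.WeilExplicitFormulaProofs
import Literature.NumberTheory.LFunctions.RiemannXi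
import HarnessLib

/-!
# `WeilGroundState.GroundStatesConvergeToXi` — translates of Riemann's kernel are Weil-harmonic
(crux item stmt-RiemannHypothesis-1527, route route-RiemannHypothesis-WeilGroundState; line `Sketch`,
stub `stub_phi_translate_harmonic` (W13); `--supports`)

With `Φ(t) = 2Ψ(2t)` Riemann's kernel (`LagariasMontague.Psic`; `Φ̂ = weilMellin Φ = ξ` by
`stub_mellinXi`), every translate `τ_{t₀}Φ = Φ(· + t₀)` lies in the exponential Weil class with
rate `1`: it is smooth, and `τ_{t₀}Φ`, `(τ_{t₀}Φ)'`, `(τ_{t₀}Φ)''` are `≤ C e^{-|t|}` (from the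
double-exponential envelope `exp(|u|/2 − (π/4)e^{2|u|}) ≤ e^{-|u|}` of `…PhiTail` and
`e^{-|t + t₀|} ≤ e^{|t₀|} e^{-|t|}`).  Its Mellin–Laplace transform is
`(τ_{t₀}Φ)^(s) = e^{-(s-1/2)t₀} ξ(s)` (translation invariance of Lebesgue measure), which vanishes
at every non-trivial zero of `ζ`; hence, GIVEN the explicit formula for the exponential class
`Σ'_ρ m(ρ) f̂(ρ) = W(f)` (hypothesis), `W(τ_{t₀}Φ) = Σ'_ρ 0 = 0`.

No new definitions; no named fact is used.
-/

noncomputable section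

set_option linter.dupNamespace false

open scoped Topology Real
open Filter Set MeasureTheory Complex

namespace Summit.RiemannHypothesis.RiemannHypothesis.Theorems.GroundStatesConvergeToXi

open Literature.NumberTheory.LFunctions

/-! ## Smoothness and derivatives of the translate `τ_{t₀}Φ` -/

/-- `τ_{t₀}Φ = Φ(· + t₀)` is smooth. [folklore] -/
theorem phiTr_contDiff (t₀ : ℝ) :
    ContDiff ℝ (⊤ : ℕ∞) (fun t : ℝ => (2 : ℂ) * LagariasMontague.Psic (2 * (t + t₀))) :=
  contDiff_phi.comp (contDiff_id.add contDiff_const)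

/-- `(τ_{t₀}Φ)' = τ_{t₀}(Φ')` with `Φ'(u) = 4Ψ'(2u)`. [folklore] -/
theorem phiTr_deriv (t₀ : ℝ) :
    deriv (fun t : ℝ => (2 : ℂ) * LagariasMontague.Psic (2 * (t + t₀))) = fun t : ℝ =>
      (4 : ℂ) * (LagariasMontague.thetaSeries (LagariasMontague.thetaδ LagariasMontague.psiPoly)
        (2 * (t + t₀)) : ℂ) :=
  funext fun t => (HasDerivAt.comp_add_const t t₀ (phi_hasDerivAt (t + t₀))).deriv

/-- `(τ_{t₀}Φ)'(t) = 4Ψ'(2(t + t₀))`. [folklore] -/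
theorem phiTr_deriv_apply (t₀ t : ℝ) :
    deriv (fun t : ℝ => (2 : ℂ) * LagariasMontague.Psic (2 * (t + t₀))) t =
      (4 : ℂ) * (LagariasMontague.thetaSeries (LagariasMontague.thetaδ LagariasMontague.psiPoly)
        (2 * (t + t₀)) : ℂ) :=
  (HasDerivAt.comp_add_const t t₀ (phi_hasDerivAt (t + t₀))).deriv

/-- `(τ_{t₀}Φ)''(t) = 8Ψ''(2(t + t₀))`. [folklore] -/
theorem phiTr_deriv_deriv_apply (t₀ t : ℝ) :
    deriv (deriv (fun t : ℝ => (2 : ℂ) * LagariasMontague.Psic (2 * (t + t₀)))) t =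
      (8 : ℂ) * (LagariasMontague.thetaSeries
        (LagariasMontague.thetaδ (LagariasMontague.thetaδ LagariasMontague.psiPoly)) (2 * (t + t₀)) : ℂ) := by
  rw [phiTr_deriv]
  exact (HasDerivAt.comp_add_const t t₀ (dphi_hasDerivAt (t + t₀))).deriv

/-! ## The envelope at rate `1` -/

/-- `exp(|u|/2 − (π/4)e^{2|u|}) ≤ e^{-|u|}`: `e^{2|u|} ≥ 1 + 2|u|` and `π > 3` give
`(π/4)e^{2|u|} ≥ (3/2)|u|`. [folklore] -/
theorem phiTr_envelope_le (u : ℝ) :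
    Real.exp (|u| / 2 - π / 4 * Real.exp (2 * |u|)) ≤ Real.exp (-|u|) := by
  rw [Real.exp_le_exp]
  have hE : π / 4 * (2 * |u| + 1) ≤ π / 4 * Real.exp (2 * |u|) :=
    mul_le_mul_of_nonneg_left (Real.add_one_le_exp (2 * |u|)) (by positivity)
  have hπ : 0 ≤ (π / 2 - 3 / 2) * |u| :=
    mul_nonneg (by linarith [Real.pi_gt_three]) (abs_nonneg u)
  nlinarith [Real.pi_pos]

/-- The translated envelope at rate `1`: `exp(|t+t₀|/2 − (π/4)e^{2|t+t₀|}) ≤ e^{|t₀|} e^{-|t|}`.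
[folklore] -/
theorem phiTr_envelope_translate_le (t t₀ : ℝ) :
    Real.exp (|t + t₀| / 2 - π / 4 * Real.exp (2 * |t + t₀|)) ≤
      Real.exp |t₀| * Real.exp (-(1 * |t|)) := by
  refine (phiTr_envelope_le (t + t₀)).trans ?_
  rw [← Real.exp_add, Real.exp_le_exp]
  have h : |t| - |t₀| ≤ |t + t₀| := abs_sub_abs_le_abs_add t t₀
  linarith

/-- From an envelope bound to the rate-`1` class bound, with room for the other two constants.
[folklore] -/
theorem phiTr_bound_of_envelope {x K K' : ℝ} {t t₀ : ℝ} (hKK' : K ≤ K')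
    (hx : x ≤ K * Real.exp (|t + t₀| / 2 - π / 4 * Real.exp (2 * |t + t₀|))) (hK : 0 ≤ K) :
    x ≤ K' * Real.exp |t₀| * Real.exp (-(1 * |t|)) := by
  have hE := phiTr_envelope_translate_le t t₀
  have h1 : K * Real.exp (|t + t₀| / 2 - π / 4 * Real.exp (2 * |t + t₀|)) ≤
      K * (Real.exp |t₀| * Real.exp (-(1 * |t|))) := mul_le_mul_of_nonneg_left hE hK
  have h2 : K * (Real.exp |t₀| * Real.exp (-(1 * |t|))) ≤
      K' * (Real.exp |t₀| * Real.exp (-(1 * |t|))) :=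
    mul_le_mul_of_nonneg_right hKK' (by positivity)
  calc x ≤ K' * (Real.exp |t₀| * Real.exp (-(1 * |t|))) := hx.trans (h1.trans h2)
    _ = K' * Real.exp |t₀| * Real.exp (-(1 * |t|)) := by ring

/-- **Class bounds of the translate.** `‖τ_{t₀}Φ‖, ‖(τ_{t₀}Φ)'‖, ‖(τ_{t₀}Φ)''‖ ≤ C e^{-|t|}` with
`C = (K₀ + K₁ + K₂) e^{|t₀|}`. [folklore] -/
theorem phiTr_bounds (t₀ : ℝ) :
    ∃ C : ℝ, ∀ t : ℝ,
      ‖(2 : ℂ) * LagariasMontague.Psic (2 * (t + t₀))‖ ≤ C * Real.exp (-(1 * |t|)) ∧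
      ‖deriv (fun t : ℝ => (2 : ℂ) * LagariasMontague.Psic (2 * (t + t₀))) t‖ ≤
        C * Real.exp (-(1 * |t|)) ∧
      ‖deriv (deriv (fun t : ℝ => (2 : ℂ) * LagariasMontague.Psic (2 * (t + t₀)))) t‖ ≤
        C * Real.exp (-(1 * |t|)) := by
  obtain ⟨K₀, hK₀, h₀⟩ := exists_norm_phi_le
  obtain ⟨K₁, hK₁, h₁⟩ := exists_norm_dphi_le
  obtain ⟨K₂, hK₂, h₂⟩ := exists_norm_ddphi_le
  refine ⟨(K₀ + K₁ + K₂) * Real.exp |t₀|, fun t => ⟨?_, ?_, ?_⟩⟩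
  · exact phiTr_bound_of_envelope (by linarith) (h₀ (t + t₀)) hK₀
  · rw [phiTr_deriv_apply]
    exact phiTr_bound_of_envelope (by linarith) (h₁ (t + t₀)) hK₁
  · rw [phiTr_deriv_deriv_apply]
    exact phiTr_bound_of_envelope (by linarith) (h₂ (t + t₀)) hK₂

/-! ## The Mellin transform of the translate -/

/-- **`(τ_{t₀}Φ)^(s) = e^{-(s-1/2)t₀} ξ(s)`** for every `s : ℂ`: substitute `u = t + t₀`
(translation invariance of Lebesgue measure) and use `Φ̂ = ξ` (`stub_mellinXi`). [folklore] -/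
theorem phiTr_weilMellin (t₀ : ℝ) (s : ℂ) :
    weilMellin (fun t : ℝ => (2 : ℂ) * LagariasMontague.Psic (2 * (t + t₀))) s =
      cexp (-((s - 1 / 2) * t₀)) * riemannXi s := by
  rw [← stub_mellinXi stub_psiDecay.1 stub_psiDecay.2 s]
  unfold weilMellin
  rw [← integral_const_mul, ← integral_add_right_eq_self
    (fun t : ℝ => cexp (-((s - 1 / 2) * t₀)) *
      (2 * LagariasMontague.Psic (2 * t) * cexp ((s - 1 / 2) * t))) t₀]
  refine integral_congr_ae (ae_of_all _ fun t => ?_)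
  dsimp only
  have e' : cexp (-((s - 1 / 2) * (t₀ : ℂ))) * cexp ((s - 1 / 2) * t₀) = 1 := by
    rw [← Complex.exp_add, neg_add_cancel, Complex.exp_zero]
  have e : cexp ((s - 1 / 2) * ((t + t₀ : ℝ) : ℂ)) =
      cexp ((s - 1 / 2) * t₀) * cexp ((s - 1 / 2) * t) := by
    rw [← Complex.exp_add]
    congr 1
    push_cast
    ring
  rw [e]
  calc (2 : ℂ) * LagariasMontague.Psic (2 * (t + t₀)) * cexp ((s - 1 / 2) * t)
      = cexp (-((s - 1 / 2) * (t₀ : ℂ))) * cexp ((s - 1 / 2) * t₀) *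
          ((2 : ℂ) * LagariasMontague.Psic (2 * (t + t₀)) * cexp ((s - 1 / 2) * t)) := by
        rw [e', one_mul]
    _ = _ := by ring

/-! ## The stub -/

/-- **Stub W13 — `phi_translate_harmonic` (RH-free; takes the class explicit formula (EF) as
hypothesis).**  Every translate `τ_{t₀}Φ = Φ(· + t₀)` of Riemann's kernel `Φ(t) = 2Ψ(2t)` lies in
the exponential Weil class with rate `1` (smooth; `τ_{t₀}Φ, (τ_{t₀}Φ)', (τ_{t₀}Φ)'' ≤ C e^{-|t|}`
from the double-exponential envelopes of `…PhiTail`), its transform is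
`(τ_{t₀}Φ)^(s) = e^{-(s-1/2)t₀} ξ(s)` (`stub_mellinXi`), and **`W(τ_{t₀}Φ) = 0`**: by (EF)
`W(τ_{t₀}Φ) = Σ'_ρ m(ρ) (τ_{t₀}Φ)^(ρ)` and `ξ(ρ) = 0` at every non-trivial zero
(`riemannXi_eq_zero_of_mem_riemannZetaNontrivialZeros`). [folklore] -/
theorem stub_phi_translate_harmonic :
    (∀ (f : ℝ → ℂ) (C b₀ : ℝ), ContDiff ℝ (⊤ : ℕ∞) f → 1 / 2 < b₀ →
      (∀ t, ‖f t‖ ≤ C * Real.exp (-(b₀ * |t|))) →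
      (∀ t, ‖deriv f t‖ ≤ C * Real.exp (-(b₀ * |t|))) →
      (∀ t, ‖deriv (deriv f) t‖ ≤ C * Real.exp (-(b₀ * |t|))) →
      Summable (fun ρ : ZetaZeros.riemannZetaNontrivialZeros =>
          ‖(riemannZetaZeroOrder (ρ : ℂ) : ℂ) * weilMellin f ρ‖) ∧
      ∑' ρ : ZetaZeros.riemannZetaNontrivialZeros,
          (riemannZetaZeroOrder (ρ : ℂ) : ℂ) * weilMellin f ρ = weilFunctional f) →
    ∀ t₀ : ℝ,
      ContDiff ℝ (⊤ : ℕ∞) (fun t : ℝ => (2 : ℂ) * LagariasMontague.Psic (2 * (t + t₀))) ∧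
      (∃ C : ℝ, ∀ t : ℝ,
        ‖(2 : ℂ) * LagariasMontague.Psic (2 * (t + t₀))‖ ≤ C * Real.exp (-(1 * |t|)) ∧
        ‖deriv (fun t : ℝ => (2 : ℂ) * LagariasMontague.Psic (2 * (t + t₀))) t‖ ≤
          C * Real.exp (-(1 * |t|)) ∧
        ‖deriv (deriv (fun t : ℝ => (2 : ℂ) * LagariasMontague.Psic (2 * (t + t₀)))) t‖ ≤
          C * Real.exp (-(1 * |t|))) ∧
      (∀ s : ℂ, weilMellin (fun t : ℝ => (2 : ℂ) * LagariasMontague.Psic (2 * (t + t₀))) s =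
        cexp (-((s - 1 / 2) * t₀)) * riemannXi s) ∧
      weilFunctional (fun t : ℝ => (2 : ℂ) * LagariasMontague.Psic (2 * (t + t₀))) = 0 := by
  intro hEF t₀
  obtain ⟨C, hC⟩ := phiTr_bounds t₀
  refine ⟨phiTr_contDiff t₀, ⟨C, hC⟩, phiTr_weilMellin t₀, ?_⟩
  obtain ⟨-, hsum⟩ := hEF (fun t : ℝ => (2 : ℂ) * LagariasMontague.Psic (2 * (t + t₀))) C 1
    (phiTr_contDiff t₀) (by norm_num) (fun t => (hC t).1) (fun t => (hC t).2.1)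
    (fun t => (hC t).2.2)
  rw [← hsum]
  refine (tsum_congr fun ρ => ?_).trans tsum_zero
  rw [phiTr_weilMellin, riemannXi_eq_zero_of_mem_riemannZetaNontrivialZeros ρ.2, mul_zero,
    mul_zero]

end Summit.RiemannHypothesis.RiemannHypothesis.Theorems.GroundStatesConvergeToXi

end
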